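import Literature.AlgebraicGeometry.Frobenioids.ModelFrobenioidTypeBridge
import Literature.AnabelianGeometry.EtaleTheta.TemperedFrobenioidCor38Sub
import Literature.AnabelianGeometry.EtaleTheta.Discharge.Sec3Thm37Standard

/-!
# [EtTh] Cor 3.8, proof l.1–2 (row C38-L01): "`C₁`, `C₂` are of standard and isotropic type, but not of
# group-like type" — the `Thm42Setting` input DISCHARGED at the canonical [FrdI] vocabulary

S. Mochizuki, *The étale theta function …*, Publ. RIMS **45** (2009) [MochizukiEtTh2009], Cor. 3.8, proof,
PDF p.81 l.1–2 (printed 307): "First, we recall that by Theorem 3.7, (i), (ii), `C₁`, `C₂` are of standard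
and isotropic type, but not of group-like type"; Thm. 3.7 (i)/(ii), PDF p.79.

Row C38-L01 of the cell's sub-DAG `plan/L2/SUBDAG-EtTh-Cor38.md` (abc-iut-w5-d124) types this sentence as
`Cor38Hyp.StandardIsotropicNotGroupLike h := PreFrobenioidData.Thm42Setting C₁.opsData C₂.opsData` — the
standing hypotheses of [FrdI] Thm. 4.2 for the operations of the two tempered Frobenioids — and both end
assemblies of Cor. 3.8 (i)/(ii) (`cor38_i_of_rows` / `cor38_ii_of_rows`, p414329) take it as a NAMED binder.
This proof-only companion (abc-iut-w5-d135) DISCHARGES it at the canonical vocabulary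
(`treeMonoidVocab`, `treeCatVocab`), where every clause is a landed theorem:
* "standard type" = Thm. 3.7 (ii) — abc-iut-w4-d103's `TemperedFrobenioid.isOfStandardType_treeCatVocab`
  (`Sec3Thm37Standard`, [FrdI] Thm 5.2 (iii)), from the Cor. 3.8 data `h.fsmff` ("`D_i` of FSMFF-type") and
  `h.nonDilating` ("`Φ_i` non-dilating"), GIVEN the one standing residual of the L2 board
  `hBmon_i : IsMonoidOn C_i.ratFnFunctor` ([FrdI] Thm 5.2 preamble: "`B` a monoid on `D`");
* "isotropic type" = Thm. 3.7 (i) — L1's `ModelFrobenioid.data_isOfIsotropicType` ([FrdI] Thm 5.2 (ii)),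
  unconditional (`B = B₀^Λ|_D ×_{(Φ^{ℝ-log})^gp} Φ^gp` group-like: `ratFnFunctor_isGroupLike_holds`);
* "not of group-like type" = Thm. 3.7 (i) — `Φ` is not the zero monoid (Def 3.6 (ii)(b);
  `not_isZeroMonoid_divisorMonoid` + L1's `ModelFrobenioid.data_isOfGroupLikeType_iff`), unconditional.
So the binder list of the Cor. 3.8 (i)/(ii) knits loses C38-L01 in favour of `hBmon₁`, `hBmon₂` (already on it).

HONEST FRAMING: refereed pre-IUT material ([EtTh] §3 over [FrdI] §3/§5); nothing here bears on [IUTchIII]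
Cor. 3.12; no statement is strengthened; typed ≠ proved — here proved modulo the displayed `hBmon_i`.
-/

namespace Literature.AnabelianGeometry.EtaleTheta

open CategoryTheory Opposite Literature.AlgebraicGeometry.Frobenioids

universe u₀ v₀ u v w

namespace TemperedFrobenioid

section General

variable {D₀ : Type u₀} [Category.{v₀} D₀] {V : FrdIMonoidStub.{w}}
  {T : RealifiedDivisorMonoids (D₀ := D₀) V} {D : Type u} [Category.{v} D]
  {VD : FrdICatStub.{u, v, w} D} (C : TemperedFrobenioid T D VD)

/-- The operations `C.opsData` of a tempered Frobenioid ARE L1's `ModelFrobenioid.data` of its defining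
data `(D, Φ, B, B → Φ^gp)` (bookkeeping, definitional). [cite: MochizukiEtTh2009, Def 3.6 p.77] -/
theorem opsData_eq_data :
    C.opsData = ModelFrobenioid.data C.divisorMonoid C.ratFnFunctor C.divBNatTrans := rfl

/-- **Thm 3.7 (i), "of isotropic type", in L1's operations language** — unconditional ([FrdI] Thm 5.2 (ii):
`B` group-like). [cite: MochizukiEtTh2009, Thm 3.7 (i) p.79] -/
theorem opsData_isOfIsotropicType : C.opsData.IsOfIsotropicType :=
  ModelFrobenioid.data_isOfIsotropicType (C.ratFnFunctor_isGroupLike T.isUnit_BΛ)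

/-- **Thm 3.7 (i), "but not of group-like type", in L1's operations language** — unconditional (`Φ` is not
the zero monoid, Def 3.6 (ii)(b)). [cite: MochizukiEtTh2009, Thm 3.7 (i) p.79] -/
theorem opsData_not_isOfGroupLikeType : ¬ C.opsData.IsOfGroupLikeType := fun h =>
  C.not_isZeroMonoid_divisorMonoid
    ((ModelFrobenioid.data_isOfGroupLikeType_iff C.divisorMonoid C.ratFnFunctor C.divBNatTrans).1 h)

/-- **Thm 3.7 (ii), "of standard type", in L1's operations language**, modulo the standing hypotheses of
[FrdI] Thm 5.2 (`ModelFrobenioid.Hypotheses`), for `D` of FSMFF-type and `Φ` non-dilating (abc-iut-w4-d103's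
`isOfStandardType_of`). [cite: MochizukiEtTh2009, Thm 3.7 (ii) p.79] -/
theorem opsData_isOfStandardType_of (hyp : ModelFrobenioid.Hypotheses C.divisorMonoid C.ratFnFunctor)
    (hD : IsOfFSMFFType D) (hnd : IsNonDilatingOn C.divisorMonoid) : C.opsData.IsOfStandardType :=
  C.isOfStandardType_of hyp hD hnd

end General

/-! ## At the canonical vocabulary -/

section TreeVocab

variable {D₀ : Type u₀} [Category.{v₀} D₀] {T : RealifiedDivisorMonoids (D₀ := D₀) treeMonoidVocab.{w}}
  {D : Type u} [Category.{v} D] {IsRational IsStrictlyRational : (Dᵒᵖ ⥤ CommMonCat.{w}) → Prop}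
  (C : TemperedFrobenioid T D (treeCatVocab D IsRational IsStrictlyRational))

/-- "`Φ` non-dilating" in the shape of `Cor38Hyp.nonDilating` at the canonical vocabulary IS the tree's
`IsNonDilatingOn Φ`. [cite: MochizukiEtTh2009, Thm 3.7 (ii) p.79] -/
theorem isNonDilatingOn_of_forall_pull
    (hnd : ∀ (A : Dᵒᵖ) (f : A ⟶ A), treeMonoidVocab.{w}.IsNonDilating (C.Φ.carrier A) (C.Φ.pull f)) :
    IsNonDilatingOn C.divisorMonoid :=
  C.isNonDilatingOn_divisorMonoid_iff.2 hnd

/-- **Thm 3.7 (ii), "of standard type", at the canonical vocabulary**, for `D` of FSMFF-type and `Φ`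
non-dilating (in the `Cor38Hyp` shape), GIVEN `hBmon : IsMonoidOn B` only.
[cite: MochizukiEtTh2009, Thm 3.7 (ii) p.79] -/
theorem opsData_isOfStandardType_treeCatVocab (hBmon : IsMonoidOn C.ratFnFunctor) (hD : IsOfFSMFFType D)
    (hnd : ∀ (A : Dᵒᵖ) (f : A ⟶ A), treeMonoidVocab.{w}.IsNonDilating (C.Φ.carrier A) (C.Φ.pull f)) :
    C.opsData.IsOfStandardType :=
  C.isOfStandardType_treeCatVocab hBmon hD (C.isNonDilatingOn_of_forall_pull hnd)

end TreeVocab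

end TemperedFrobenioid

/-! ## Row C38-L01 discharged -/

namespace Cor38Hyp

variable {D₀ : Type u₀} [Category.{v₀} D₀] {D₀' : Type u₀} [Category.{v₀} D₀']
  {T : RealifiedDivisorMonoids (D₀ := D₀) treeMonoidVocab.{w}}
  {T' : RealifiedDivisorMonoids (D₀ := D₀') treeMonoidVocab.{w}}
  {D : Type u} [Category.{v} D] {D' : Type u} [Category.{v} D']
  {IsRational IsStrictlyRational : (Dᵒᵖ ⥤ CommMonCat.{w}) → Prop}
  {IsRational' IsStrictlyRational' : (D'ᵒᵖ ⥤ CommMonCat.{w}) → Prop}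
  {C₁ : TemperedFrobenioid T D (treeCatVocab D IsRational IsStrictlyRational)}
  {C₂ : TemperedFrobenioid T' D' (treeCatVocab D' IsRational' IsStrictlyRational')}

/-- **C38-L01 — "by Theorem 3.7, (i), (ii), `C₁`, `C₂` are of standard and isotropic type, but not of
group-like type" — DISCHARGED at the canonical vocabulary**: the [FrdI] Thm 4.2 setting
`StandardIsotropicNotGroupLike h` of the two tempered Frobenioids of Cor. 3.8 holds, GIVEN only the standing
residual `hBmon_i : IsMonoidOn C_i.ratFnFunctor` ([FrdI] Thm 5.2 preamble) for `i = 1, 2`; "`D_i` of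
FSMFF-type" and "`Φ_i` non-dilating" are the fields `h.fsmff`, `h.nonDilating` of the Cor. 3.8 data.
[cite: MochizukiEtTh2009, Cor 3.8 p.81] -/
theorem standardIsotropicNotGroupLike_treeCatVocab (h : Cor38Hyp C₁ C₂)
    (hBmon₁ : IsMonoidOn C₁.ratFnFunctor) (hBmon₂ : IsMonoidOn C₂.ratFnFunctor) :
    h.StandardIsotropicNotGroupLike :=
  ⟨⟨C₁.opsData_isOfStandardType_treeCatVocab hBmon₁ h.fsmff.1 h.nonDilating.1,
      C₂.opsData_isOfStandardType_treeCatVocab hBmon₂ h.fsmff.2 h.nonDilating.2⟩,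
    ⟨C₁.opsData_isOfIsotropicType, C₂.opsData_isOfIsotropicType⟩,
    ⟨C₁.opsData_not_isOfGroupLikeType, C₂.opsData_not_isOfGroupLikeType⟩⟩

/-- The symmetric setting (for the `Ψ⁻¹`-directions of the knits), likewise discharged.
[cite: MochizukiEtTh2009, Cor 3.8 p.81] -/
theorem thm42Setting_symm_treeCatVocab (h : Cor38Hyp C₁ C₂)
    (hBmon₁ : IsMonoidOn C₁.ratFnFunctor) (hBmon₂ : IsMonoidOn C₂.ratFnFunctor) :
    PreFrobenioidData.Thm42Setting C₂.opsData C₁.opsData :=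
  h.standardIsotropicNotGroupLike_symm (h.standardIsotropicNotGroupLike_treeCatVocab hBmon₁ hBmon₂)

end Cor38Hyp

/-! ## Over an arbitrary vocabulary: the two unconditional clauses, and the whole setting from the
## [FrdI] Thm 5.2 hypotheses -/

namespace Cor38Hyp

variable {D₀ : Type u₀} [Category.{v₀} D₀] {D₀' : Type u₀} [Category.{v₀} D₀'] {V : FrdIMonoidStub.{w}}
  {T : RealifiedDivisorMonoids (D₀ := D₀) V} {T' : RealifiedDivisorMonoids (D₀ := D₀') V}
  {D : Type u} [Category.{v} D] {D' : Type u} [Category.{v} D']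
  {VD : FrdICatStub.{u, v, w} D} {VD' : FrdICatStub.{u, v, w} D'}
  {C₁ : TemperedFrobenioid T D VD} {C₂ : TemperedFrobenioid T' D' VD'}

/-- **C38-L01 over any vocabulary, modulo the [FrdI] Thm 5.2 standing hypotheses** (`ModelFrobenioid.Hypotheses`
for both data: `Φ_i` divisorial monoids on `D_i`, `B_i` monoids on `D_i`) and the tree's non-dilating condition
on `Φ_i`; isotropic / not-group-like are unconditional. [cite: MochizukiEtTh2009, Cor 3.8 p.81] -/
theorem standardIsotropicNotGroupLike_of_hypotheses (h : Cor38Hyp C₁ C₂)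
    (hyp₁ : ModelFrobenioid.Hypotheses C₁.divisorMonoid C₁.ratFnFunctor)
    (hyp₂ : ModelFrobenioid.Hypotheses C₂.divisorMonoid C₂.ratFnFunctor)
    (hnd₁ : IsNonDilatingOn C₁.divisorMonoid) (hnd₂ : IsNonDilatingOn C₂.divisorMonoid) :
    h.StandardIsotropicNotGroupLike :=
  ⟨⟨C₁.opsData_isOfStandardType_of hyp₁ h.fsmff.1 hnd₁, C₂.opsData_isOfStandardType_of hyp₂ h.fsmff.2 hnd₂⟩,
    ⟨C₁.opsData_isOfIsotropicType, C₂.opsData_isOfIsotropicType⟩,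
    ⟨C₁.opsData_not_isOfGroupLikeType, C₂.opsData_not_isOfGroupLikeType⟩⟩

end Cor38Hyp

end Literature.AnabelianGeometry.EtaleTheta
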